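import Mathlib
import HarnessLib
import Summits.HubbardSuperconductivity.HubbardSuperconductivity.Theorems.KLProgrammeKLRegimeEngineTowerBlockZeroReadoutF
import Summits.HubbardSuperconductivity.HubbardSuperconductivity.Theorems.KLProgrammeKLRegimeEngineTowerBlockZeroBaseF
import Summits.HubbardSuperconductivity.HubbardSuperconductivity.Theorems.KLProgrammeKLRegimeEngineTowerBlockZeroPartitionFn
import Summits.HubbardSuperconductivity.HubbardSuperconductivity.Theorems.KLProgrammeKLRegimeEngineTowerPartialIncrLevStepFOne
import Summits.HubbardSuperconductivity.HubbardSuperconductivity.Theorems.KLProgrammeKLRegimeKernelNormsLevelsFloorTracks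

/-!
# Route `KLProgramme` — crux K3 ENGINE (stmt-HubbardSuperconductivity-20437 `KLRegimeEngineV17F2`), stub (b) v2, THE LEVELS PACKAGE (ℓ): «(ℓ)-BLOCK0-PACKAGE» —
# block `0` on the flow frame as ONE theorem sharing ONE set of pinned constants: the partition function at `Λ_j`, the tower's base unit law at `(j, j−1)`
# and the levels closer at `j`, `1 ≤ j ≤ d` (cell gate-hubbard-kl, seat gate-hubbard-kl-p3 g22; merges this seat's `kernelNormsLevels_blockZeroF_klEng`
# (…TowerBlockZeroReadoutFKlEng), `baseLawF_blockZeroF_klEng` (…TowerBlockZeroBaseFKlEng) and `towerZ_blockZero_klEng` (…TowerBlockZeroPartitionFn) — each of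
# which obtains p3 g21's `linkDataBlockZeroF_klEng` separately and therefore pins its own opaque `Cκ Cb CJ` — into one statement with one obtain)

WHY.  The rows assembly `kernelNormsLevels_all_klEng_final_rows` (p698561) takes, besides the block-`0` group keyed on `kernelNormsLevels_blockZeroF_klEng`'s pins,
the main tower's base rows (`Nb hcar hlawb` at `(d, d−1)`) and `Z^{K_n}_{Λ_d} ≠ 0` as binders; their suppliers (F8, link 5) would each introduce a SECOND family of
opaque pinned constants.  One obtain of `linkDataBlockZeroF_klEng` serves all three uses: the born step of `𝒱_j − 𝒱_1` at `F_1` (`partialIncrLevF_le_kitStep_of_bounds'`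
at `(1,1)`), the partition function at `Λ_j` (`towerZ_partial_of_bounds` at `(1,1)`, same kit guard), the base unit law (`baseLawF_blockZero_sharp`, `j ≥ 2`,
read-out constants `Cinc₁ Dinc₁ ≥ 1`) and the levels closer (`readoutLevF_le_levelsRHS_blockZero_sharp` ∘ `kernelNormsLevels_of_floorTracks`, constants `Cinc Dinc`).
So the binder list is `kernelNormsLevels_blockZeroF_klEng`'s (through the five smallness rows) plus ONE binder — the block-`0` kit guard
`Φ·towerV D τ (m ↦ W·Z^m·klTowerMuLevF … (K_n) 1 1 m) < 1` — and the conclusion is the conjunction (1) `Z^{K_n}_{Λ_j} ≠ 0` ∧ (2) (`2 ≤ j →` field cap `→` base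
read-out constants `→` the base unit law `klTowerMeasLev … (K_n) j 1 (2p) (t+1) / klLevUnitF … t p (j−1) ≤ Atot₁·λ_j^{p−1}·Qtot₁^p`, every `p ≥ 3`) ∧ (3) (levels
read-out constants `→ CE` threshold `→` field cap `→` six-leg cell `→ KernelNormsLevels … (K_n) j`).  At `j := d` conjuncts (1)–(2) are exactly the base group of
the rows assembly, with `Nb := klTowerMeasLev … (K_n) d 1` (`hNb0 ∧ hcar` = `klTowerMeasLev_one_baseRows`).

* **`blockZeroPackage_klEng (d c″)`**.
Composition of landed theorems; nothing about the model is asserted beyond them; nothing asserts (ℓ), any stub, K3 or superconductivity.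
References: BGM 2006 §2.3 (2.13)–(2.14), §2.8 (2.76)–(2.84), (2.93)–(2.98), Lemma 2.5, §3 (3.2)–(3.8) [cite: BenfattoGiulianiMastropietro2006].
-/

noncomputable section

namespace Summit.HubbardSuperconductivity.HubbardSuperconductivity.Theorems.EngineV8

set_option linter.dupNamespace false -- summit = problem name (single-conjunct summit), D-0017

open Classical
open Real Finset Literature.MathematicalPhysics.QuantumLattice Literature.Probability.LatticeModels GrassmannAlgebra
open Literature.Probability.LatticeModels.BattleFederbush
open Literature.MathematicalPhysics.QuantumLattice.FermiRG
open Summit.HubbardSuperconductivity.HubbardSuperconductivity.Theorems.KLProgrammeLegKernels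
open Summit.HubbardSuperconductivity.HubbardSuperconductivity.Theorems.KLRegimeSplit
open Summit.HubbardSuperconductivity.HubbardSuperconductivity.Theorems.KLRegimeWick
open Summit.HubbardSuperconductivity.HubbardSuperconductivity.Theorems.TorusFourierL2
open Summit.HubbardSuperconductivity.HubbardSuperconductivity.Theorems.DispersionFlow

variable {L M : ℕ} [NeZero L] [NeZero M]

set_option maxHeartbeats 400000 in -- one ~80-binder composition with three conclusions
/-- **BLOCK `0` ON THE FLOW FRAME AS ONE PACKAGE: PARTITION FUNCTION, BASE UNIT LAW, LEVELS CLOSER — ONE SET OF PINS** (see the module docstring).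
[cite: BenfattoGiulianiMastropietro2006, §2.8 (2.76)-(2.84), Lemma 2.5 (2.98), §3 (3.2)-(3.8)] -/
theorem blockZeroPackage_klEng (d : ℕ) (c'' : ℝ) (hc'' : 0 < c'') :
    ∃ Cinc Dinc Cinc₁ Dinc₁ : ℝ, 0 < Cinc ∧ 1 ≤ Dinc ∧ 1 ≤ Cinc₁ ∧ 1 ≤ Dinc₁ ∧
    ∀ R : RenConsts, R.WF2 → ∃ c₃' : ℝ, 0 < c₃' ∧ ∃ U₀' : ℝ, 0 < U₀' ∧
      ∃ Cκ Cb CJ : ℝ, 0 < Cκ ∧ 0 < Cb ∧ 0 < CJ ∧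
      ∀ (G : GeoConsts) (P : SplitConsts) (Qh : EngConsts) (c : ℝ), P.WF → 0 < c → c ≤ klEngC₃6 P R → c ≤ c₃' →
      ∀ μ ∈ klWindowC, ∀ U : ℝ, 0 < U → U ≤ klEngU₀9 P R c → U ≤ U₀' → c'' * U ≤ 1 → ∀ β : ℝ, klBetaMin ≤ β → β ≤ Real.exp (c / U ^ 2) →
      ∀ (L M : ℕ) [NeZero L] [NeZero M], klEngL₃ β U ≤ L → klEngM₃ β U L ≤ M →
      ∀ n : ℕ, 1 ≤ n → n ≤ nScales β + 1 → IsKLRegime U c (-(n : ℤ)) →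
        HistP klPredsV17F2 L M G P Qh R β U μ 0 n → FrameOK R U (nScales β) μ (klFlowFrameU L M β U μ n) →
        (∀ m, 1 ≤ m → m < n → FlowPieceOscAt L M c'' β U μ m) →
      -- the read-out level `1 ≤ j ≤ d` of block `0`, the degree cap
      ∀ j D : ℕ, 1 ≤ j → j ≤ d → j ≤ n → 3 ≤ D →
      -- the partition function at `Λ_1` on the flow frame (E1's Z-chain / `exists_partitionFn_scaleOne_ne_zero`)
      hubbardEffPartitionFnCT L M β U μ 0 (klFlowFrameU L M β U μ n) (klScale klE0 1) ≠ 0 →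
      ∀ (B Ab Qb : ℝ), 1 ≤ B → 0 ≤ Ab → 0 ≤ Qb →
      -- the level-`0` datum: `𝒱_1[K_n]` at `F_0` and its unit law at `J = 0`, at `λ = B·ε_j`
      ∀ Nb : Fin 5 → ℕ → ℝ, (∀ t p, 0 ≤ Nb t p) →
        (∀ (t : Fin 5) (p : ℕ) (Ωe' : Fin (2 * p) → Option (SectorLeg (sectorCount 0))), levelCount Ωe' = (t : ℕ) + 1 →
          klLevNormOf L M β μ (klFlowFrameU L M β U μ n) 0 (2 * p) (klTowerInput L M β U μ (klFlowFrameU L M β U μ n) 1 1) Ωe' ≤ Nb t p) →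
        (∀ (t : Fin 5) (p : ℕ), 3 ≤ p → Nb t p / klLevUnitF β M t p 0 ≤ Ab * (B * epsCoupling P U j) ^ (p - 1) * Qb ^ p) →
      -- the block-`0` kit cap at the input label set
      Fintype.card (SpaceTimeIdx L M × SectorLeg (sectorCount 0)) / 2 ≤ D →
      -- the thick-block data DISCHARGED (`blockZeroIncrLevF_le_kitStep_klEng`): the four constants pinned, then the law's six names pinned (equational binders)
      ∀ (κb αb crb ccb : ℝ), κb = Real.sqrt (2 * Cκ * klE0) → αb = Cb * ((M : ℝ) / β) * (4 : ℝ) ^ d / klE0 →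
        crb = 81 * CJ * M / β → ccb = 162 * CJ * M / β →
      ∀ (W Z σ Φ ψ τ : ℝ), W = 64 * (27 : ℝ) ^ 4 * exp 2 * crb / ccb → Z = exp 4 * ccb ^ 2 * imagTimeWeight β M ^ 2 / 8 →
        σ = κb ^ 2 / (exp 4 * ccb ^ 2) → Φ = 9 * αb * ccb / ((27 : ℝ) ^ 5 * exp 1 * κb ^ 2 * crb) → ψ = exp 4 * ccb ^ 2 / κb ^ 2 →
        τ = exp 2 * κb ^ 2 / ccb ^ 2 →
      -- the Chernoff data of the level-`0` datum in floor units and the imports (E1 / level-`0` numerics)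
      ∀ (A' Q' ι₁ ι₂ ι₃ : ℝ), 0 ≤ A' → 0 < Q' →
      (∀ m, 4 ≤ m → m ≤ D → W * Z ^ m * klTowerMuLevF L M β U μ (klFlowFrameU L M β U μ n) 1 1 m ≤ A' * (B * epsCoupling P U j) ^ (m - 1) * Q' ^ m) →
      W * Z ^ 3 * klTowerMuLevF L M β U μ (klFlowFrameU L M β U μ n) 1 1 3 ≤ ι₃ * (B * epsCoupling P U j) ^ 2 →
      W * Z ^ 1 * klTowerMuLevF L M β U μ (klFlowFrameU L M β U μ n) 1 1 1 ≤ ι₁ * (B * epsCoupling P U j) →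
      W * Z ^ 2 * klTowerMuLevF L M β U μ (klFlowFrameU L M β U μ n) 1 1 2 ≤ ι₂ * (B * epsCoupling P U j) →
      -- the five smallness rows at `(A′, Q′, λ)` (numerics)
      4 * σ * (B * epsCoupling P U j) * Q' < 1 → 2 * (B * epsCoupling P U j) * τ * Q' ≤ 1 → exp 1 * τ * (B * epsCoupling P U j) * Q' < 1 →
      Φ * (τ * (ι₁ * (B * epsCoupling P U j) + ι₂ / (2 * Q') + ι₃ / (4 * Q' ^ 2) + A' * Q' / 4)) < 1 →
      Φ * (exp 1 * τ * (ι₁ * (B * epsCoupling P U j)) + (exp 1 * τ) ^ 2 * (ι₂ * (B * epsCoupling P U j)) +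
          (exp 1 * τ) ^ 3 * (ι₃ * (B * epsCoupling P U j) ^ 2) +
        A' * (exp 1 * τ * Q') * ((exp 1 * τ * (B * epsCoupling P U j) * Q') ^ 3 / (1 - exp 1 * τ * (B * epsCoupling P U j) * Q'))) < 1 →
      -- the block-`0` kit guard (serves the born step AND the partition function)
      Φ * towerV D τ (fun m => W * Z ^ m * klTowerMuLevF L M β U μ (klFlowFrameU L M β U μ n) 1 1 m) < 1 →
      -- (1) the partition function at `Λ_j`
      hubbardEffPartitionFnCT L M β U μ 0 (klFlowFrameU L M β U μ n) (klScale klE0 j) ≠ 0 ∧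
      -- (2) the tower's base unit law at `(j, j−1)` for `j ≥ 2` (read-out constants of `baseLawF_blockZero_sharp`, `Cinc₁ Dinc₁ ≥ 1`)
      (2 ≤ j → Fintype.card (HubbardFieldIdx L M) ≤ 2 * D + 1 →
        ∀ (Aro₁ Qro₁ Qtot₁ Atot₁ : ℝ), Aro₁ = Cinc₁ * Ab → Qro₁ = Dinc₁ * Qb → Qtot₁ = Dinc₁ * max 1 (max Qro₁ (max (4 * Q') (2 * τ * ψ * Q'))) →
          Atot₁ = Aro₁ + Cinc₁ * (A' * (4 * σ * (B * epsCoupling P U j) * Q' / (1 - 4 * σ * (B * epsCoupling P U j) * Q')) +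
            exp 1 * (τ * (ι₁ * (B * epsCoupling P U j) + ι₂ / (2 * Q') + ι₃ / (4 * Q' ^ 2) + A' * Q' / 4)) *
              (Φ * (τ * (ι₁ * (B * epsCoupling P U j) + ι₂ / (2 * Q') + ι₃ / (4 * Q' ^ 2) + A' * Q' / 4)) /
                (1 - Φ * (τ * (ι₁ * (B * epsCoupling P U j) + ι₂ / (2 * Q') + ι₃ / (4 * Q' ^ 2) + A' * Q' / 4)))) / (2 * τ * Q')) →
        ∀ (t : Fin 5) (p : ℕ), 3 ≤ p →
          klTowerMeasLev L M β U μ (klFlowFrameU L M β U μ n) j 1 (2 * p) ((t : ℕ) + 1) / klLevUnitF β M t p (j - 1) ≤ Atot₁ * (B * epsCoupling P U j) ^ (p - 1) * Qtot₁ ^ p) ∧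
      -- (3) the levels closer at `j` (read-out constants of `readoutLevF_le_levelsRHS_blockZero_sharp`, `Cinc Dinc`)
      (∀ (Aro Qro Qtot Atot : ℝ), Aro = Cinc * Ab → Qro = Dinc * Qb → Qtot = Dinc * max 1 (max Qro (max (4 * Q') (2 * τ * ψ * Q'))) →
        Atot = Aro + Cinc * (A' * (4 * σ * (B * epsCoupling P U j) * Q' / (1 - 4 * σ * (B * epsCoupling P U j) * Q')) +
          exp 1 * (τ * (ι₁ * (B * epsCoupling P U j) + ι₂ / (2 * Q') + ι₃ / (4 * Q' ^ 2) + A' * Q' / 4)) *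
            (Φ * (τ * (ι₁ * (B * epsCoupling P U j) + ι₂ / (2 * Q') + ι₃ / (4 * Q' ^ 2) + A' * Q' / 4)) /
              (1 - Φ * (τ * (ι₁ * (B * epsCoupling P U j) + ι₂ / (2 * Q') + ι₃ / (4 * Q' ^ 2) + A' * Q' / 4)))) / (2 * τ * Q')) →
      ∀ Qe : EngConsts, Qtot * imagTimeWeight β M ^ 2 * B * max 1 (Atot / imagTimeWeight β M) ≤ Qe.CE →
      Fintype.card (HubbardFieldIdx L M) ≤ 2 * D + 1 →
      (∀ Ωe : Fin (2 * 3) → Option (SectorLeg (sectorCount j)), levelCount Ωe = 1 →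
        klAnisoLegKernelNormAt L M β U μ (klFlowFrameU L M β U μ n) klE0 j (2 * 3) Ωe ≤ Qe.CE ^ 3 * (epsCoupling P U j) ^ 2 * (2 : ℝ) ^ ((4 : ℤ) * j)) →
      KernelNormsLevels L M P Qe β U μ (klFlowFrameU L M β U μ n) j) := by
  obtain ⟨Cinc, Dinc, hCinc, hDinc, hF⟩ := readoutLevF_le_levelsRHS_blockZero_sharp
  obtain ⟨Cinc₁, Dinc₁, hCinc₁, hDinc₁, hB⟩ := baseLawF_blockZero_sharp
  refine ⟨Cinc, Dinc, Cinc₁, Dinc₁, hCinc, hDinc, hCinc₁, hDinc₁, fun R hR2 => ?_⟩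
  obtain ⟨c₃, hc₃, U₀, hU₀, hF'⟩ := hF R hR2
  obtain ⟨c₃b, hc₃b, U₀b, hU₀b, hB'⟩ := hB R hR2
  obtain ⟨Cκ, Cb, CJ, hCκ, hCb, hCJ, h⟩ := linkDataBlockZeroF_klEng d R c'' hc''
  refine ⟨min c₃ c₃b, lt_min hc₃ hc₃b, min U₀ U₀b, lt_min hU₀ hU₀b, Cκ, Cb, CJ, hCκ, hCb, hCJ, ?_⟩
  intro G P Qh c hP hc hc6 hc₃' μ hμ U hU hU9 hU₀' hcU β hβmin hβc L M _ _ hL3 hM3 n hn1 hnN hreg hhist hfr hosc j D hj1 hjd hjn hD3 hZ1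
    B Ab Qb hB hAb hQb Nb hNb0 hcar hlawb hDcap κb αb crb ccb hκb hαb hcrb hccb W Z σ Φ ψ τ hW hZ hσ hΦ hψ hτ
    A' Q' ι₁ ι₂ ι₃ hA'0 hQ'0 hprof hprof3 himp₁ himp₂ hx₁ hx₂ hx₃ hy hθ hguard
  have hcA : c ≤ c₃ := hc₃'.trans (min_le_left _ _)
  have hcB : c ≤ c₃b := hc₃'.trans (min_le_right _ _)
  have hUA : U ≤ U₀ := hU₀'.trans (min_le_left _ _)
  have hUB : U ≤ U₀b := hU₀'.trans (min_le_right _ _)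
  have he : (0 : ℝ) < klE0 := by norm_num [klE0]
  have hβ : 0 < β := KLRegimeSplit.pos_of_klBetaMin_le hβmin
  have hM0 : (0 : ℝ) < M := Nat.cast_pos.2 (Nat.pos_of_ne_zero (NeZero.ne M))
  have hK1 : 1 ≤ P.Klam := hP.1
  have hK0 : 0 < P.Klam := lt_of_lt_of_le one_pos hK1
  have hjN : j ≤ nScales β + 1 := hjn.trans hnN
  have hx : 0 < imagTimeWeight β M := imagTimeWeight_pos_of_pos (M := M) hβ
  have hB0 : 0 < B := lt_of_lt_of_le one_pos hB
  have hεj : 0 < epsCoupling P U j := by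
    unfold epsCoupling
    have : 0 < |U| + U ^ 2 * (j : ℝ) := by positivity
    positivity
  have hlam : 0 < B * epsCoupling P U j := mul_pos hB0 hεj
  -- positivity of the pinned constants
  have hκb0 : 0 < κb := by rw [hκb]; exact Real.sqrt_pos.2 (by positivity)
  have hαb0 : 0 < αb := by rw [hαb]; positivity
  have hcrb0 : 0 < crb := by rw [hcrb]; positivity
  have hccb0 : 0 < ccb := by rw [hccb]; positivity
  have hW0 : 0 < W := by rw [hW]; positivity
  have hZ0 : 0 < Z := by rw [hZ]; positivity
  have hσ0 : 0 ≤ σ := by rw [hσ]; positivity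
  have hΦ0 : 0 ≤ Φ := by rw [hΦ]; positivity
  have hψ0 : 0 ≤ ψ := by rw [hψ]; positivity
  have hτ0 : 0 < τ := by rw [hτ]; positivity
  -- the thick block's data on `K_n` (ONE obtain: the born step and the partition function share the pins)
  obtain ⟨hκ0', hκκb, hGB, hrow, hcol, hαle, -, -⟩ :=
    h G P Qh c hP hR2 hc hc6 μ hμ U hU hU9 hcU β hβmin hβc L M hL3 hM3 n hn1 hnN hreg hhist hfr hosc j hj1 hjd hjn
  obtain ⟨-, -, -, -, -, -, hrow1, hcol1⟩ :=
    h G P Qh c hP hR2 hc hc6 μ hμ U hU hU9 hcU β hβmin hβc L M hL3 hM3 n hn1 hnN hreg hhist hfr hosc 1 le_rfl (hj1.trans hjd) (hj1.trans hjn)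
  -- the born step of `𝒱_j − 𝒱_1` at `F_1` in the pinned names
  have hborn : ∀ N : ℕ, 1 ≤ N → Φ * towerV D τ (fun m => W * Z ^ m * klTowerMuLevF L M β U μ (klFlowFrameU L M β U μ n) 1 1 m) < 1 →
      ∀ (t : Fin 5) (q : ℕ) (Ωe : Fin (2 * q + 1 + 1) → Option (SectorLeg (sectorCount 1))), levelCount Ωe = (t : ℕ) + 1 →
      klLevNormOf L M β μ (klFlowFrameU L M β U μ n) 1 (2 * q + 1 + 1)
          (klEffectiveAction L M β U μ (klFlowFrameU L M β U μ n) klE0 j - klTowerInput L M β U μ (klFlowFrameU L M β U μ n) 1 1) Ωe /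
          klLevUnitF β M t (q + 1) 1 ≤
        towerFO D σ (fun m => W * Z ^ m * klTowerMuLevF L M β U μ (klFlowFrameU L M β U μ n) 1 1 m) (q + 1) +
          ∑ n' ∈ Icc 2 N, exp 1 * Φ ^ (n' - 1) * ψ ^ (q + 1) *
            towerS D τ (fun m => W * Z ^ m * klTowerMuLevF L M β U μ (klFlowFrameU L M β U μ n) 1 1 m) n' (q + 1) +
          ψ ^ (q + 1) * exp 1 * towerV D τ (fun m => W * Z ^ m * klTowerMuLevF L M β U μ (klFlowFrameU L M β U μ n) 1 1 m) *
            (Φ * towerV D τ (fun m => W * Z ^ m * klTowerMuLevF L M β U μ (klFlowFrameU L M β U μ n) 1 1 m)) ^ N /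
            (1 - Φ * towerV D τ (fun m => W * Z ^ m * klTowerMuLevF L M β U μ (klFlowFrameU L M β U μ n) 1 1 m)) := by
    subst hW hZ hσ hΦ hψ hτ hκb hαb hcrb hccb
    intro N hN hg t q Ωe hΩe
    exact partialIncrLevF_le_kitStep_of_bounds' (d := 1) (k := 1) hβ U μ _ le_rfl le_rfl (by simpa using hj1) hZ1 hκ0' hκb0 hκκb hGB hαb0 hαle
      hrow hcol hcrb0 hccb0 hrow1 hcol1 hDcap hN hg t q Ωe hΩe
  refine ⟨?_, ?_, ?_⟩
  · -- (1) the partition function along the thick block under the guard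
    have hg : 9 * αb * ccb / ((27 : ℝ) ^ 5 * exp 1 * κb ^ 2 * crb) *
        towerV D (exp 2 * κb ^ 2 / ccb ^ 2)
          (fun m => 64 * (27 : ℝ) ^ 4 * exp 2 * crb / ccb * (exp 4 * ccb ^ 2 * imagTimeWeight β M ^ 2 / 8) ^ m *
            klTowerMuLevF L M β U μ (klFlowFrameU L M β U μ n) 1 1 m) < 1 := by
      rw [hΦ, hτ, hW, hZ] at hguard; exact hguard
    subst hκb hαb hcrb hccb
    exact towerZ_partial_of_bounds (d := 1) (k := 1) hβ U μ _ le_rfl le_rfl (by simpa using hj1) hZ1 hκ0' hκb0 hκκb hGB hαb0 hαle hrow hcol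
      hcrb0 hccb0 hDcap hg
  · -- (2) the base unit law at `(j, j−1)`
    intro hj2 hcard Aro₁ Qro₁ Qtot₁ Atot₁ hAro₁ hQro₁ hQtot₁ hAtot₁ t p hp
    exact hB' P c hP hc hc6 hcB μ hμ U hU hU9 hUB β hβmin hβc (klFlowFrameU L M β U μ n) hfr L M hL3 hM3 j D hj2 (by omega) hD3 hcard
      (B * epsCoupling P U j) Ab Qb hlam hAb hQb Nb hNb0 hcar hlawb W Z σ Φ ψ τ A' Q' ι₁ ι₂ ι₃ hW0 hZ0 hσ0 hΦ0 hψ0 hτ0 hA'0 hQ'0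
      hprof hprof3 himp₁ himp₂ hx₁ hx₂ hx₃ hy hθ hborn Aro₁ Qro₁ Qtot₁ Atot₁ hAro₁ hQro₁ hQtot₁ hAtot₁ t p hp
  · -- (3) the levels closer at `j`
    intro Aro Qro Qtot Atot hAro hQro hQtot hAtot Qe hCE hcard hsix
    have hDinc0 : 0 < Dinc := lt_of_lt_of_le one_pos hDinc
    have hQtot0 : 0 ≤ Qtot := by rw [hQtot]; exact mul_nonneg hDinc0.le (zero_le_one.trans (le_max_left _ _))
    have hCE0 : 0 ≤ Qe.CE := by
      refine le_trans ?_ hCE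
      have : 0 ≤ max 1 (Atot / imagTimeWeight β M) := zero_le_one.trans (le_max_left _ _)
      positivity
    have hro : ∀ (t : Fin 5) (p : ℕ), 3 ≤ p → p ≤ D → 7 ≤ 2 * p + (t : ℕ) →
        ∀ Ωe : Fin (2 * p) → Option (SectorLeg (sectorCount j)), levelCount Ωe = (t : ℕ) + 1 →
        klLevNormOf L M β μ (klFlowFrameU L M β U μ n) j (2 * p) (klEffectiveAction L M β U μ (klFlowFrameU L M β U μ n) klE0 j) Ωe ≤
          Qe.CE ^ p * epsCoupling P U j ^ (p - 1) * (2 : ℝ) ^ ((3 * (p : ℤ) - 5) * j) * (((2 : ℝ) ^ j)⁻¹) ^ levelGainExp ((t : ℕ) + 1) :=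
      fun t p hp hpD hpt Ωe hlev =>
        hF' P c hP hc hc6 hcA μ hμ U hU hU9 hUA β hβmin hβc (klFlowFrameU L M β U μ n) hfr L M hL3 hM3 j D hj1 hjN hD3 B Ab Qb hB hAb hQb
          Nb hNb0 hcar hlawb W Z σ Φ ψ τ A' Q' ι₁ ι₂ ι₃ hW0 hZ0 hσ0 hΦ0 hψ0 hτ0 hA'0 hQ'0 hprof hprof3 himp₁ himp₂ hx₁ hx₂ hx₃ hy hθ hborn
          Aro Qro Qtot Atot hAro hQro hQtot hAtot Qe.CE hCE t p hp hpD hpt Ωe hlev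
    exact kernelNormsLevels_of_floorTracks hβ.le hCE0 hK0.le hD3 hcard
      (fun t _ p hp hpD hpt Ωe hc => by rw [← klLevNormOf_klEffectiveAction]; exact hro t p hp hpD hpt Ωe hc) hsix

end Summit.HubbardSuperconductivity.HubbardSuperconductivity.Theorems.EngineV8

end
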